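import Summits.BirchSwinnertonDyer.BirchSwinnertonDyer.Theorems.ByReductionTypeAtTwoOrdKatoHalfAtTwoIsoCoreTheoremATwoResidue
import Summits.BirchSwinnertonDyer.BirchSwinnertonDyer.Theorems.ByReductionTypeAtTwoOrdKatoHalfAtTwoIsoPortCount
import Literature.NumberTheory.EllipticCurves.Kato2004.EulerSystemBoundFineSelmerTwo
import HarnessLib

/-!
# Stub-critic probe (gen 3) for `stub_port : CoreTheoremATwoResidue`
# (crux `ByReductionTypeAtTwo.OrdKatoHalfAtTwoIso`, stmt-BirchSwinnertonDyer-19573, line `steinberg-fibre-at-two`)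

Seat `scrit-stub_port` (planner, stub-critic), gen 3, 2026-08-28. Scratch / evidence only — NOT a Theorems proposal;
nothing new is asserted. Three checks, all BY NAME against the tree as of skeleton v8 (sha16 `632723940faa924f`):

§1  The statement the two STUB-IDEAS files and STUB-PLAN rev 1 planned for now has a canonical landed name,
    `SteinbergFibreAtTwo.coreTheoremATwoResidue_holds` (p669276, lead, 21:19:34Z); the payload's VERBATIM `stub_port`
    signature (skeleton v3 l.213–229) follows from it binder for binder through `coreTheoremATwoResidue_iff` (p655368).
§2  By-name verification of every tree declaration cited in the GEN 2 ADDENDUM of `STUB-IDEAS-stub_port-2.md`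
    (sha16 `a906c15c55b295ca`; its MR04 (H.0)–(H.6) fate table): each `#check` below must elaborate.
    ONE CORRECTION found by the critic: the count lemma consumed inside `coreTwoResidue_of_rankOne` (p658966) is the
    prime-generic X9 lemma `CoreAssembly.convCoeff_zero_one_eq_zero_of_reciprocity` (file `…X9CoreAlgebra`, applied with
    `Nat.prime_two`, `m := a`), NOT `PortCount`'s `CoreAssembly.convCoeff_zero_one_two_eq_zero_of_reciprocity` (p658620),
    which exists but lies OUTSIDE the closing cone (31 of 35 `…OrdKatoHalfAtTwoIso*.lean` files are in the import cone of
    the four Ω roots; outside: PortCount, PortEngines, PortStepTwoElement, and the downstream closing file p669276).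
§3  What the LINE still owes, by the landed conditional theorem `ordKatoHalfAtTwoIso_of_memo_cite` (p669276): exactly the
    four registered stubs of skeleton v8 (`stub_F1_two`, `stub_AU`, `stub_B7B8_katoOffResidue_memo`, `stub_pub`).
BSD is not proved by any of this; the crux `OrdKatoHalfAtTwoIso` is not proved (conditional on four binders).
-/

set_option autoImplicit false
set_option linter.dupNamespace false

noncomputable section

open scoped Classical NumberField MatrixGroups ModularForm
open WeierstrassCurve Field IsDedekindDomain NumberField
open Literature.NumberTheory.GaloisRepresentations
open Literature.NumberTheory.GaloisCohomology
open Literature.NumberTheory.EllipticCurves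
open Literature.NumberTheory.EllipticCurves.Kato2004
open Literature.NumberTheory.EllipticCurves.Kato2004.EulerSystemValues
open Summit.BirchSwinnertonDyer.BirchSwinnertonDyer.Theorems.SteinbergFibreAtTwo
open Literature.NumberTheory.EllipticCurves.ModularForms
open Summit.BirchSwinnertonDyer.BirchSwinnertonDyer.Theorems.OrdKatoIntAtTwo
open Summit.BirchSwinnertonDyer.BirchSwinnertonDyer.Theorems.OrdKatoOptimalAtTwo
open CongruenceSubgroup

namespace Summit.BirchSwinnertonDyer.BirchSwinnertonDyer.Cruxes.OrdKatoHalfAtTwoIso.StubCriticStubPortG3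

/-! ## §1 The stub's statement under its landed name, binder for binder -/

/-- **`stub_port` is the landed theorem `coreTheoremATwoResidue_holds`** (p669276). [cite: MazurRubin2004, Prop. 1.3.2 and §3] -/
example : CoreTheoremATwoResidue := coreTheoremATwoResidue_holds

/-- **Binder-for-binder**: the payload's verbatim `stub_port` signature (skeleton v3 l.213–229 = p655368 l.96 body),
from the landed name through the unfolding lemma `coreTheoremATwoResidue_iff`. [folklore] -/
theorem stub_port_signature_verbatim_of_holds :
    ∀ (W : WeierstrassCurve ℚ) [W.IsElliptic] [W.IsGloballyMinimal]
      [ContinuousSMul ℤ_[2] (W.tateModule 2)] [Module.Free ℤ_[2] (W.tateModule 2)]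
      [Module.Finite ℤ_[2] (W.tateModule 2)]
      (κ : ZpExtension ℚ 2) (γ : absoluteGaloisGroup ℚ) (I : IwasawaH1Data W 2 κ γ)
      (hκ : κ.IsCyclotomic),
      W.HasGoodReductionAtPrime 2 → ¬ (2 : ℤ) ∣ W.frobeniusTrace 2 →
      W.HasSurjectiveModNGaloisRep 2 → W.Δ < 0 → κ.IsTopGenerator γ →
      (∃ s : I.H, IsEulerSystemClassTwo W hκ I s ∧
        s ∉ IwasawaAlgebra.augIdealP 2 • (⊤ : Submodule (IwasawaAlgebra 2) I.H)) →
      ∃ J : ℕ, ∀ y : Literature.NumberTheory.EllipticCurves.subgroupH1 κ.kerSubgroup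
          (WeierstrassCurve.geomTorsion W (2 : ℤ)),
        W.torsionToPrimaryH1Sub 2 κ.kerSubgroup y ∈ W.fineSelmerInfty κ →
          (⇑(Literature.NumberTheory.EllipticCurves.conjH1 κ.kerSubgroup
              (WeierstrassCurve.geomTorsion W (2 : ℤ)) γ -
            AddMonoidHom.id (Literature.NumberTheory.EllipticCurves.subgroupH1 κ.kerSubgroup
              (WeierstrassCurve.geomTorsion W (2 : ℤ)))))^[J] y = 0 :=
  coreTheoremATwoResidue_iff.mp coreTheoremATwoResidue_holds

#print axioms coreTheoremATwoResidue_holds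
#print axioms stub_port_signature_verbatim_of_holds

/-! ## §2 By-name verification of the GEN 2 ADDENDUM's fate table (STUB-IDEAS-stub_port-2.md @a906c15c55b295ca) -/

-- (H.0) coefficients as `Fin J → E[2]` with the shift
#check @Literature.NumberTheory.EllipticCurves.convCoeff
#check @Literature.NumberTheory.EllipticCurves.shiftEnd
#check @Summit.BirchSwinnertonDyer.BirchSwinnertonDyer.Theorems.SteinbergFibreAtTwo.modPTwist_shiftEnd_pow_apply
-- (H.1) Irr(2) ⇐ Surj(2); no vector fixed by [G,G] (H-F)
#check @Literature.NumberTheory.EllipticCurves.hasIrreducibleModPGaloisRep_of_hasSurjectiveModNGaloisRep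
#check @Summit.BirchSwinnertonDyer.BirchSwinnertonDyer.Rank1Residual.geomTorsion_eq_zero_of_fixed_of_commutator_le_two
-- (H.2) τ ↦ transposition Frobenius of depth ≥ n; ker N = im N; existence by open-subgroup Chebotarev + HCEngine; c a transposition
#check @Summit.BirchSwinnertonDyer.BirchSwinnertonDyer.Theorems.SteinbergFibreAtTwo.toLocal_twistModP_apply_of_mem_layerSubgroup_of_le
#check @Summit.BirchSwinnertonDyer.BirchSwinnertonDyer.Theorems.SteinbergFibreAtTwo.exists_depth_of_isArithFrobAt
#check @Summit.BirchSwinnertonDyer.BirchSwinnertonDyer.Theorems.SteinbergFibreAtTwo.KThree.neg_castLE_eq_shiftEnd_pow_compLeft_sub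
#check @Literature.NumberTheory.GaloisRepresentations.exists_isArithFrobAt_mul_inv_mem_not_mem
#check @Summit.BirchSwinnertonDyer.BirchSwinnertonDyer.Theorems.SteinbergFibreAtTwo.sign_permGal_eq_neg_one_of_isComplexConjugation_of_Δ_neg
-- (H.3) Steinberg–Sah at 2 + layer part (D)
#check @Summit.BirchSwinnertonDyer.BirchSwinnertonDyer.Theorems.SteinbergFibreAtTwo.SahRelNormal.oneCocycleClass_eq_zero_of_forall_mem_eq_zero_of_normal
#check @Summit.BirchSwinnertonDyer.BirchSwinnertonDyer.Rank1Residual.ker_galoisRepTorsion_sup_kerSubgroup_eq_top_two_of_irreducible_of_Δ_neg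
#check @Summit.BirchSwinnertonDyer.BirchSwinnertonDyer.Theorems.SteinbergFibreAtTwo.permGal_kerSubgroup_surjective_of_sign_eq_neg_one
-- (H.4) replaced by the joint Chebotarev choice with a non-degenerate bottom pairing
#check @Summit.BirchSwinnertonDyer.BirchSwinnertonDyer.Theorems.SteinbergFibreAtTwo.stableProd_eq_top_or_diagonal
#check @Summit.BirchSwinnertonDyer.BirchSwinnertonDyer.Theorems.SteinbergFibreAtTwo.exists_mem_stableProd_smul_add_ne
#check @Summit.BirchSwinnertonDyer.BirchSwinnertonDyer.Theorems.SteinbergFibreAtTwo.weilPairingHom_two_smul_sub_ne_zero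
-- (H.5) one-prime annihilation, T^ε device
#check @Summit.BirchSwinnertonDyer.BirchSwinnertonDyer.Rank1Residual.StepFour.localTerm_iterate_shiftH1_eq_zero_of_stub_hypotheses_of_inl
-- (H.6) real place killed by Δ < 0; finite places off S₁
#check @Summit.BirchSwinnertonDyer.BirchSwinnertonDyer.Rank1Residual.localization_inl_modPTwist_two_eq_zero_of_Δ_neg
#check @Summit.BirchSwinnertonDyer.BirchSwinnertonDyer.Rank1Residual.two_nsmul_modPTwist_two_eq_zero
#check @Summit.BirchSwinnertonDyer.BirchSwinnertonDyer.Rank1Residual.StepFour.localTerm_inr_eq_zero_of_unramified_outside_set_two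
-- core rank row: the count.  USED in `coreTwoResidue_of_rankOne` (prime-generic X9 lemma, `Nat.prime_two`, `m := a`):
#check @Summit.BirchSwinnertonDyer.BirchSwinnertonDyer.Rank1Residual.CoreAssembly.convCoeff_zero_one_eq_zero_of_reciprocity
--   cited by the addendum instead (PortCount p658620 — exists, correct, but NOT in the closing cone):
#check @Summit.BirchSwinnertonDyer.BirchSwinnertonDyer.Rank1Residual.CoreAssembly.convCoeff_zero_one_two_eq_zero_of_reciprocity
#check @Summit.BirchSwinnertonDyer.BirchSwinnertonDyer.Theorems.SteinbergFibreAtTwo.coreTwoResidue_of_rankOne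
-- transversality row (B2 taken): hp2-free Kolyvagin cocycle, q-term identity at a transposition prime, tr × ur perfect at prime powers
#check @Summit.BirchSwinnertonDyer.BirchSwinnertonDyer.Rank1Residual.KolyvaginTwist.exists_kolyvaginCocycle_value_noTransverse
#check @Summit.BirchSwinnertonDyer.BirchSwinnertonDyer.Theorems.SteinbergFibreAtTwo.exists_unit_qTermIdentity_transposition
#check @Summit.BirchSwinnertonDyer.BirchSwinnertonDyer.Theorems.SteinbergFibreAtTwo.eq_zero_of_mem_transverse_of_forall_unramified_pairing_eq_zero_primePow
-- unit polynomial / level arithmetic row: the p = 2 Kolyvagin package and its inputs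
#check @Summit.BirchSwinnertonDyer.BirchSwinnertonDyer.Theorems.SteinbergFibreAtTwo.exists_kolyvaginPackage_two
#check @Summit.BirchSwinnertonDyer.BirchSwinnertonDyer.Rank1Residual.TameClass.exists_tameClass_of_isEulerSystemClassTwo
#check @Summit.BirchSwinnertonDyer.BirchSwinnertonDyer.Theorems.SteinbergFibreAtTwo.exists_tameCocycle_valueInput_two
#check @Summit.BirchSwinnertonDyer.BirchSwinnertonDyer.Theorems.SteinbergFibreAtTwo.RedTowerTwo.localization_redTower_mem_unramifiedSubgroup
-- «𝔛 finite ⟸ T^i 𝔛 = 0» row: upstream kernel glue of p655368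
#check @Summit.BirchSwinnertonDyer.BirchSwinnertonDyer.Theorems.SteinbergFibreAtTwo.mu_eq_zero_on_residue_of_sockets
-- the two PROVED tree facts discharged inside `stub_port_of_rankOne`, the all-prime Selmer side, the composition, the producer of the class binder
#check @Literature.NumberTheory.EllipticCurves.Kato2004.mem_pSmul_of_red_eq_zero_holds
#check @Literature.NumberTheory.GaloisCohomology.poitouTate_sum_localTatePairing_eq_zero_holds
#check @Summit.BirchSwinnertonDyer.BirchSwinnertonDyer.Rank1Residual.SelmerDual.stub_selmerDualTwo_holds
#check @Summit.BirchSwinnertonDyer.BirchSwinnertonDyer.Theorems.SteinbergFibreAtTwo.stub_port_of_rankOne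
#check @Summit.BirchSwinnertonDyer.BirchSwinnertonDyer.Theorems.SteinbergFibreAtTwo.stub_T1_selmerSideTwo
#check @Summit.BirchSwinnertonDyer.BirchSwinnertonDyer.Theorems.SteinbergFibreAtTwo.stub_HC_chebotarevTranspositionTwo
#check @Summit.BirchSwinnertonDyer.BirchSwinnertonDyer.Theorems.SteinbergFibreAtTwo.stub_HK_kolyvaginRankOneTwo
#check @Literature.NumberTheory.EllipticCurves.Kato2004.isEulerSystemClassTwo_of_zetaBody

/-! ## §3 What the LINE still owes, by the landed conditional theorem (p669276) — exactly skeleton v8's four stubs -/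

/-- The crux from the four remaining registered stubs of skeleton v8, by name (`stub_pub` ≡ `OrdPublishedInputsAtTwo`).
Conditional; nothing closed. [cite: Kato2004Asterisque, Thm. 17.4 (1)(2) (p. 273)] [cite: AbbesUllmo1996, Thm. A] -/
theorem crux_of_skeleton_v8_stubs (hF1 : DivisibilityInputsFineZetaAtTwoResidue)
    (hAU : abbesUllmo_not_dvd_maninConstant_of_not_dvd_level)
    (hB7B8 : KatoMuPartAtOptimalMemberOfNotSurjectiveTwo ∧ KatoIntAtGoodOrdSurjectiveTwo)
    (hPub : Summit.BirchSwinnertonDyer.BirchSwinnertonDyer.Theses.ByReductionTypeAtTwo.OrdPublishedInputsAtTwo) :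
    Summit.BirchSwinnertonDyer.BirchSwinnertonDyer.Theses.ByReductionTypeAtTwo.OrdKatoHalfAtTwoIso :=
  ordKatoHalfAtTwoIso_of_memo_cite hF1 hAU hB7B8.1 hB7B8.2 hPub

#print axioms crux_of_skeleton_v8_stubs

end Summit.BirchSwinnertonDyer.BirchSwinnertonDyer.Cruxes.OrdKatoHalfAtTwoIso.StubCriticStubPortG3

end
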